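import Mathlib
import Summits.NavierStokesRegularity.NavierStokesRegularity.Theorems.EulerZoomLiouvillePowerGaugeEulerLiouvilleSelfSimilarWeakHomogeneousTailTools
import Summits.NavierStokesRegularity.NavierStokesRegularity.Theorems.EulerZoomLiouvillePowerGaugeEulerLiouvilleSelfSimilarEndpointShellSpread
import HarnessLib

/-!
# Weak self-similar profiles at the endpoint `ρ = 1/2` with a dyadically homogeneous tail of degree
# `−β`, `β < 4`, are compactly supported (Chae–Shvydkoy 2013, Thm 4.2 (ii)–(iii), weak class)

Route №10 `EulerZoomLiouville` (NavierStokesRegularity), crux E = stmt-NavierStokesRegularity-19832,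
registered open stub `stub_selfSimilarWeakRest`, endpoint `ρ = 1/2` (`γ = 2/5`, `V ∈ L²` by the
`A`-gauge).  Sequel of `…SelfSimilarWeakHomogeneousTail` (off-natural tails, `ρ < 1/2`) and of the
tree's `…SelfSimilarHomogeneousTail` (`β = 3/2`: a dyadically `−3/2`-homogeneous tail is null).

* `WeakTail.selfSimilar_half_tail_ae_zero_of_dyadicHomogeneous` — crux hypotheses verbatim at
  `ρ = 1/2`, exact self-similarity, `V(2y) = 2^{−β} V(y)` for `|y| ≥ R₀ > 0` with `β < 4`, and (used
  only for `β > 3/2`) sublinear growth `‖V(y)‖ ≤ C_up |y|^{1−δ}` a.e. far out ⇒ `V = 0` a.e. on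
  `{|y| ≥ R₀}`: the profile is COMPACTLY SUPPORTED.  With `m = ∫_{S_0}|V|²` and shells
  `∫_{S_k}|V|² = 2^{k(3−2β)} m`: for `β ≤ 3/2` the shells are not summable against `V ∈ L²` unless
  `m = 0`; for `3/2 < β < 4` they are a shell lower bound `c₀ L^{−5+η}`, `η = 8 − 2β > 0`, along
  `L = 2^k R₀`, contradicting the energy drain (`EndpointSpread.selfSimilar_half_false_of_shellLower`)
  unless `m = 0`.

The compactly supported endpoint profile itself — CS13 Thm 4.2 (iii), second half, proved in print by
vorticity transport in `C¹` — stays the recorded open residue of the weak class, as do tails with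
`β ≥ 4` (at or below the drain rate).

WHAT THIS IS NOT: not NS, not E, not the stub — a portrait lemma (compact support), not triviality.
[cite: ChaeShvydkoy2013, §4.1 Thm. 4.2 (ii)–(iii)]
-/

noncomputable section

-- flat `Theorems/<Route><Decl>…` files of one crux share the namespace of the crux (tree convention)
set_option linter.dupNamespace false

open MeasureTheory Set Filter Topology Metric Function TopologicalSpace Finset
open scoped ENNReal NNReal

namespace Summit.NavierStokesRegularity.NavierStokesRegularity.Theorems.PowerGaugeEulerLiouville

open Literature.Analysis Literature.Analysis.FunctionSpaces Literature.Analysis.FluidPDE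

namespace WeakTail

section Endpoint

/-- **At the endpoint `ρ = 1/2`: a dyadically homogeneous tail of degree `−β`, `β < 4`, is NULL** (the
profile is compactly supported in `B_{R₀}`).  Crux hypotheses verbatim at `ρ = 1/2`, exact
self-similarity, `V(2y) = 2^{−β} V(y)` for `|y| ≥ R₀ > 0`, and — used only when `β > 3/2` — sublinear
growth `‖V(y)‖ ≤ C_up|y|^{1−δ}` a.e. far out.  For `β ≤ 3/2` the shells `2^{k(3−2β)} m` are not
summable against `V ∈ L²` (`A`-gauge) unless `m = 0` (the tree's `β = 3/2` lemma extended); for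
`3/2 < β < 4` they are a shell lower bound `c₀ L^{−5+η}`, `η = 8 − 2β > 0`, along `L = 2^k R₀`,
contradicting the drain (`EndpointSpread.selfSimilar_half_false_of_shellLower`) unless `m = 0`.
The compactly supported endpoint profile itself is the open residue (CS13 Thm 4.2 (iii), 2nd half,
weak class). [cite: ChaeShvydkoy2013, §4.1 Thm. 4.2 (ii)–(iii)] -/
theorem selfSimilar_half_tail_ae_zero_of_dyadicHomogeneous
    {u : ℝ → EuclideanSpace ℝ (Fin 3) → EuclideanSpace ℝ (Fin 3)}
    {p : ℝ → EuclideanSpace ℝ (Fin 3) → ℝ}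
    {H : ℝ → EuclideanSpace ℝ (Fin 3) → EuclideanSpace ℝ (Fin 3) →L[ℝ] EuclideanSpace ℝ (Fin 3)}
    {c : ℝ≥0} {V : EuclideanSpace ℝ (Fin 3) → EuclideanSpace ℝ (Fin 3)}
    {P : EuclideanSpace ℝ (Fin 3) → ℝ}
    (hsw : IsSuitableWeakSolutionOn (slab (EuclideanSpace ℝ (Fin 3)) (Iio 0) isOpen_Iio) 0 0 u p)
    (hH : HasWeakSpatialGradientOn (slab (EuclideanSpace ℝ (Fin 3)) (Iio 0) isOpen_Iio) u H)
    (hgauge : ∀ a : ℝ, 0 < a →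
      ENNReal.ofReal (a ^ (2 * (1 / 2 : ℝ))) * cknA a (0 : ℝ × EuclideanSpace ℝ (Fin 3)) u +
          ENNReal.ofReal (a ^ (1 / 2 : ℝ)) * cknE a (0 : ℝ × EuclideanSpace ℝ (Fin 3)) H +
        ENNReal.ofReal (a ^ (2 * (1 / 2 : ℝ))) * cknD a (0 : ℝ × EuclideanSpace ℝ (Fin 3)) p ≤
          (c : ℝ≥0∞))
    (hu : ∀ τ : ℝ, τ < 0 → u τ = selfSimilarCollapse (1 / (2 + (1 / 2 : ℝ))) 0 V τ)
    (hp : ∀ τ : ℝ, τ < 0 → p τ = selfSimilarCollapsePressure (1 / (2 + (1 / 2 : ℝ))) 0 P τ)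
    {δ Cup R₁ : ℝ} (hδ : 0 < δ) (hδ1 : δ ≤ 1) (hCup : 0 ≤ Cup)
    (hup : ∀ᵐ y ∂volume, R₁ ≤ ‖y‖ → ‖V y‖ ≤ Cup * ‖y‖ ^ (1 - δ))
    {β R₀ : ℝ} (hR₀ : 0 < R₀) (hβ4 : β < 4)
    (hhom : ∀ y : EuclideanSpace ℝ (Fin 3), R₀ ≤ ‖y‖ → V ((2 : ℝ) • y) = ((2 : ℝ) ^ (-β)) • V y) :
    V =ᵐ[volume.restrict {y : EuclideanSpace ℝ (Fin 3) | R₀ ≤ ‖y‖}] 0 := by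
  have hA : ∀ a : ℝ, 0 < a → ENNReal.ofReal (a ^ (2 * (1 / 2 : ℝ))) *
      cknA a (0 : ℝ × EuclideanSpace ℝ (Fin 3)) u ≤ (c : ℝ≥0∞) :=
    fun a ha => le_trans (le_trans le_self_add le_self_add) (hgauge a ha)
  have hum : AEStronglyMeasurable (uncurry u)
      (volume.restrict (Iio (0 : ℝ) ×ˢ (univ : Set (EuclideanSpace ℝ (Fin 3))))) := by
    have := hH.locallyIntegrableOn.aestronglyMeasurable
    simpa [slab] using this
  have hVm := aestronglyMeasurable_profile hum hu
  have hL2 := lintegral_enorm_sq_profile_le_of_half hu hA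
  set m : ℝ≥0∞ := ∫⁻ y in {y : EuclideanSpace ℝ (Fin 3) | R₀ ≤ ‖y‖ ∧ ‖y‖ < 2 * R₀}, ‖V y‖ₑ ^ 2 with hm
  set s : ℝ := 3 - 2 * β with hs
  have hshell : ∀ k : ℕ, ∫⁻ y in {y : EuclideanSpace ℝ (Fin 3) | (2 : ℝ) ^ k * R₀ ≤ ‖y‖ ∧
      ‖y‖ < (2 : ℝ) ^ (k + 1) * R₀}, ‖V y‖ₑ ^ 2 = ENNReal.ofReal ((2 : ℝ) ^ (s * k)) * m := fun k =>
    lintegral_shell_eq_of_dyadicHomogeneous_rpow hR₀ hhom k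
  have htail_sum := lintegral_tail_eq_tsum_shells (V := V) hR₀
  -- the tail energy is finite (`V ∈ L²`)
  have htail_fin : ∫⁻ y in {y : EuclideanSpace ℝ (Fin 3) | R₀ ≤ ‖y‖}, ‖V y‖ₑ ^ 2 < ⊤ :=
    lt_of_le_of_lt (setLIntegral_le_lintegral _ _) (lt_of_le_of_lt hL2 ENNReal.coe_lt_top)
  -- it suffices that `m = 0`
  suffices hm0 : m = 0 by
    have htail0 : ∫⁻ y in {y : EuclideanSpace ℝ (Fin 3) | R₀ ≤ ‖y‖}, ‖V y‖ₑ ^ 2 = 0 := by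
      rw [htail_sum]; simp only [hshell, hm0, mul_zero, tsum_zero]
    have hae := (lintegral_eq_zero_iff' ((hVm.restrict).aemeasurable.enorm.pow_const 2)).1 htail0
    filter_upwards [hae] with y hy
    have hy' : ‖V y‖ₑ ^ 2 = 0 := hy
    rwa [pow_eq_zero_iff two_ne_zero, enorm_eq_zero] at hy'
  by_contra hm0
  have hmtop : m ≠ ⊤ := by
    refine ne_top_of_le_ne_top htail_fin.ne ?_
    rw [htail_sum]
    refine le_trans (le_of_eq ?_) (ENNReal.le_tsum 0)
    rw [hshell 0]; simp
  rcases le_or_gt β (3 / 2) with hβ | hβ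
  · -- `β ≤ 3/2`: `s ≥ 0`, every shell carries at least `m`: not summable
    have hge : ∀ k : ℕ, m ≤ ENNReal.ofReal ((2 : ℝ) ^ (s * k)) * m := by
      intro k
      have h1 : (1 : ℝ≥0∞) ≤ ENNReal.ofReal ((2 : ℝ) ^ (s * k)) := by
        rw [← ENNReal.ofReal_one]
        exact ENNReal.ofReal_le_ofReal (Real.one_le_rpow (by norm_num)
          (mul_nonneg (by rw [hs]; linarith) (Nat.cast_nonneg k)))
      calc m = 1 * m := (one_mul m).symm
        _ ≤ ENNReal.ofReal ((2 : ℝ) ^ (s * k)) * m := mul_le_mul' h1 le_rfl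
    have hinf : ∑' k : ℕ, ENNReal.ofReal ((2 : ℝ) ^ (s * k)) * m = ⊤ := by
      refine eq_top_iff.2 (le_trans (le_of_eq (ENNReal.tsum_const_eq_top_of_ne_zero (α := ℕ) hm0).symm) ?_)
      exact ENNReal.tsum_le_tsum hge
    rw [htail_sum] at htail_fin
    simp only [hshell] at htail_fin
    exact (lt_top_iff_ne_top.1 htail_fin) hinf
  · -- `3/2 < β < 4`: the shells are a lower bound `c₀ L^{-5+η}` along `L = 2^k R₀`, `η = 8 - 2β > 0`
    have hη : 0 < s + 5 := by rw [hs]; linarith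
    have hm0' : 0 < m.toReal := ENNReal.toReal_pos hm0 hmtop
    set c₀ : ℝ := m.toReal * R₀ ^ (-s) with hc₀
    have hc₀0 : 0 < c₀ := mul_pos hm0' (Real.rpow_pos_of_pos hR₀ _)
    refine EndpointSpread.selfSimilar_half_false_of_shellLower hsw hH hgauge hu hp hδ hδ1 hCup hup
      hc₀0 hη fun L₁ => ?_
    -- a dyadic radius `L = 2^k R₀ ≥ L₁`
    have hgrow : Tendsto (fun k : ℕ => (2 : ℝ) ^ k * R₀) atTop atTop :=
      (tendsto_pow_atTop_atTop_of_one_lt (by norm_num : (1 : ℝ) < 2)).atTop_mul_const hR₀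
    obtain ⟨k, hk⟩ := (hgrow.eventually_ge_atTop L₁).exists
    refine ⟨(2 : ℝ) ^ k * R₀, hk, le_of_eq ?_⟩
    -- the shell energy at `L = 2^k R₀` is `2^{s k} m = c₀ L^{s}` and `L^{s} = L^{-5 + (s+5)}`
    have hLk : (0 : ℝ) < (2 : ℝ) ^ k * R₀ := by positivity
    have hset : {y : EuclideanSpace ℝ (Fin 3) | (2 : ℝ) ^ k * R₀ ≤ ‖y‖ ∧ ‖y‖ < 2 * ((2 : ℝ) ^ k * R₀)} =
        {y : EuclideanSpace ℝ (Fin 3) | (2 : ℝ) ^ k * R₀ ≤ ‖y‖ ∧ ‖y‖ < (2 : ℝ) ^ (k + 1) * R₀} := by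
      ext y; simp only [mem_setOf_eq, pow_succ]; constructor <;> rintro ⟨h1, h2⟩ <;>
        exact ⟨h1, by linarith⟩
    have hint : ∫ y in {y : EuclideanSpace ℝ (Fin 3) | (2 : ℝ) ^ k * R₀ ≤ ‖y‖ ∧ ‖y‖ < 2 * ((2 : ℝ) ^ k * R₀)},
        ‖V y‖ ^ 2 = ((2 : ℝ) ^ (s * k)) * m.toReal := by
      rw [hset, integral_eq_lintegral_of_nonneg_ae (Eventually.of_forall fun y => sq_nonneg _)
        (hVm.norm.pow 2).restrict]
      have e : ∫⁻ y in {y : EuclideanSpace ℝ (Fin 3) | (2 : ℝ) ^ k * R₀ ≤ ‖y‖ ∧ ‖y‖ < (2 : ℝ) ^ (k + 1) * R₀},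
          ENNReal.ofReal (‖V y‖ ^ 2) = ENNReal.ofReal ((2 : ℝ) ^ (s * k)) * m := by
        rw [← hshell k]
        exact lintegral_congr fun y => by rw [← ofReal_norm, ENNReal.ofReal_pow (norm_nonneg _)]
      rw [e, ENNReal.toReal_mul, ENNReal.toReal_ofReal (by positivity)]
    rw [hint, hc₀, Real.mul_rpow (by positivity) hR₀.le, show -(5 : ℝ) + (s + 5) = s by ring,
      ← Real.rpow_natCast, ← Real.rpow_mul (by norm_num : (0 : ℝ) ≤ 2), mul_comm (k : ℝ) s]
    have hRR : R₀ ^ (-s) * R₀ ^ s = 1 := by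
      rw [← Real.rpow_add hR₀, neg_add_cancel, Real.rpow_zero]
    calc m.toReal * R₀ ^ (-s) * ((2 : ℝ) ^ (s * k) * R₀ ^ s)
        = (2 : ℝ) ^ (s * k) * m.toReal * (R₀ ^ (-s) * R₀ ^ s) := by ring
      _ = (2 : ℝ) ^ (s * k) * m.toReal := by rw [hRR, mul_one]

end Endpoint

end WeakTail

end Summit.NavierStokesRegularity.NavierStokesRegularity.Theorems.PowerGaugeEulerLiouville

end
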